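import Literature.MathematicalPhysics.QuantumFieldTheory.Balaban1983to89.Node00.OpsYCubeDirInverse
import Literature.MathematicalPhysics.QuantumFieldTheory.Balaban1983to89.Node00.OpsYCubeLetterLaws
import Literature.MathematicalPhysics.QuantumFieldTheory.Balaban1983to89.B9Thm311LocalInversePosY
import Literature.MathematicalPhysics.QuantumFieldTheory.Balaban1983to89.B9Ineq349SiteAdjoint
import Literature.MathematicalPhysics.QuantumFieldTheory.Balaban1983to89.Node00.OpsYLocalInverseSeq

/-!
# NODE 00 — `G′_□(U)` WITH DIRICHLET EXTERIOR (`GpDirY`): SYMMETRY FOR THE TRACE PAIRING AND THE TRANSPOSED LOCAL-INVERSE LAW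

[B9] Theorem 3.11 p. 416: *"Δ′_a … is a symmetric, positive definite operator"*; p. 394 (3.24)–(3.25): `Δ′_a↾Ω₀ = Ω₀Δ′_aΩ₀`, *"Its inverse is denoted by G′"*;
(3.87)–(3.88) p. 409: the local inverses `G′_□(U)` with `h_□ Δ′_a G′_□ h_□ = h_□²` and its transpose `h_□ G′_□ Δ′_a h_□ = h_□²` (the form used when the parametrix
(3.87) is applied from the right, (3.90)); in print both follow from `G′_□ = (Δ′_a↾Ω_n(□))⁻¹` and the locality of `Δ′_a` (p. 408 l. 35 – p. 409 l. 5).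

WHY THIS FILE.  ✓`Node00.OpsYCubeDirInverse` (FILE E) typed the P4 letter `GpDirY i □ par S = (𝟙_S Δ′_{a,□}(U) 𝟙_S)⁻¹` with its support ∕ inverse ∕ locality laws and
the LEFT local-inverse law (`cutMulY_deltaPrimeAY_GpDirY_cutMulY`, the consumer's `hOloc`, by ROW agreement of `Δ′_a` and `Δ′_{a,□}` near □).  The member-wide knit
head («KE₉X-A» ✓) displays two more laws of its generic cube letter `O`: `hOsym : IsSymmTr 1 (O x □ U)` and the TRANSPOSED law `hOlocT : h_□ O Δ′_a(U) h_□ = h_□²`.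
This file supplies both for `O := GpDirY … (S x □)` BY NAME: the symmetry from that of `Δ′_{a,□}(U)` (r05's ✓`deltaPrimeACubeY_isSymmTr_of_inv_symm`; at the knit
table `parKnitY` GIVEN unitary knit legs, and at `parSymY`), and `hOlocT` from `IsUnit (𝟙_SΔ′_{a,□}𝟙_S ⊕ 1)` ALONE by COLUMN agreement (✓`OpsYLocalInverseSeq.deltaPrimeAY_mul_cutMulY_eq'`,
the road of ✓`OpsYLocalInverseSeq` for `G′_□ = GpCubeY`) — no symmetry, any site transporter, any coefficient algebra.

* §1 (generic, any finite site type, operators on `S → M_N(ℂ)`) `isSymmTr_one`, ★ `isSymmTr_sandwich` (`P T P`), `isSymmTr_dirPadY`, ★ `isSymmTr_dirInvY` (n06-j ✓`isSymmTr_ringInverse`).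
* §2 `cubeProjY_isSymmTr`, `padDeltaCubeY_isSymmTr_of`, ★ `GpDirY_isSymmTr_of`, `GpDirY_isSymmTr_of_inv_symm`, ★★ `GpDirY_parKnitY_isSymmTr` (the consumer's `hOsym`, the
  unitarity of the knit legs `hpar` DISPLAYED — in the tree today only inside the [B7] Prop-2 window, ✓`parKnitY_mem_unitary_of_reg335P`), `GpDirY_parSymY_isSymmTr`.
* §3 `cutMulY_GpDirY_deltaPrimeACubeY_cutMulY` (pure algebra, against `Δ′_{a,□}`), ★★ `cutMulY_GpDirY_deltaPrimeAY_cutMulY` (the consumer's `hOlocT`: `IsUnit (padDeltaCubeY …)`,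
  `supp h ⊆ S`, stencil-support of `h` near □; at `h := h_□` the last is ✓`OpsYLocalInverseSeq.nearH_of_mem_stencilY_hTY`).

Exact finite-dimensional algebra over landed letters; the regime (`IsUnit (padDeltaCubeY …)`) stays a HYPOTHESIS; no estimate; nothing continuum ∕ OS ∕ mass gap ∕ Clay.
-/

namespace Literature.MathematicalPhysics.QuantumFieldTheory.Balaban1983to89.Node00.OpsYCubeDirInverseSymm

open B6KLevelCensusIndexV1 (KIdx)
open B6Cover236MultiLevelBlocks (cubes)
open B9Thm311ReadingCoords (trIP IsSymmTr)
open B9Ineq349SiteAdjoint (isSymmTr_ringInverse)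
open B9Thm311DeltaPrimeSymm (isSymmTr_add)
open B9Thm311AdjointPairs (isSymmTr_sub)
open B9Thm311LocalInversePosY (trIP_cubeProjY_right trIP_cubeProjY_left)
open B9Thm311CubeLettersFirstThree (deltaPrimeACubeY_isSymmTr_of_inv_symm deltaPrimeACubeY_parSymY_isSymmTr)
open B9CubeLettersOpsL0 (deltaPrimeACubeY)
open B9CubeSequence408 (NearH)
open OpsYLocalInverseSeq (deltaPrimeAY_mul_cutMulY_eq')
open B9B8AveragingJunction (parKnitY parKnitY_inv)
open B9Thm37CubeCoverCommutators (cutMulY stencilY)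
open OpsYLocalInverse (dirPadY dirInvY cubeProjY cubeProjY_mul_cutMulY cutMulY_mul_cubeProjY)
open OpsYCubeDirInverse (padDeltaCubeY GpDirY GpDirY_mul_cubeProjY GpDirY_mul_compr_deltaPrimeACubeY)
open scoped Matrix

noncomputable section

/-! ## §1 Symmetric-operator algebra for the trace pairing (generic) -/

section Generic

variable {S : Type} [Fintype S] {N : ℕ}

/-- the identity operator is symmetric. [cite: Balaban1985BackgroundPropagators, Thm 3.11 p.416 («symmetric»), bookkeeping] -/
theorem isSymmTr_one (w : S → ℝ) : IsSymmTr w (1 : Module.End ℂ (S → Matrix (Fin N) (Fin N) ℂ)) := fun _ _ => rfl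

/-- ★ a symmetric SANDWICH `P T P` of symmetric operators is symmetric. [cite: Balaban1985BackgroundPropagators, (3.24) p.394 («Ω₀Δ′_aΩ₀»), Thm 3.11 p.416] -/
theorem isSymmTr_sandwich {w : S → ℝ} {P T : Module.End ℂ (S → Matrix (Fin N) (Fin N) ℂ)} (hP : IsSymmTr w P) (hT : IsSymmTr w T) :
    IsSymmTr w (P * T * P) := by
  intro Φ Ψ
  rw [Module.End.mul_apply, Module.End.mul_apply, hP, hT, hP, Module.End.mul_apply, Module.End.mul_apply]

/-- the padded compression `P T P + (1 − P)` of a symmetric operator by a symmetric idempotent is symmetric.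
[cite: Balaban1985BackgroundPropagators, (3.24) p.394 («Δ′_a↾Ω₀ = Ω₀Δ′_aΩ₀»), Thm 3.11 p.416] -/
theorem isSymmTr_dirPadY {w : S → ℝ} {P T : Module.End ℂ (S → Matrix (Fin N) (Fin N) ℂ)} (hP : IsSymmTr w P) (hT : IsSymmTr w T) :
    IsSymmTr w (dirPadY P T) :=
  isSymmTr_add w (isSymmTr_sandwich hP hT) (isSymmTr_sub (isSymmTr_one w) hP)

/-- ★ hence the compression-inverse `P (P T P + 1 − P)⁻¹ P` is symmetric (invertible or not). [cite: Balaban1985BackgroundPropagators, (3.25) p.394 («Its inverse is denoted by G′»), Thm 3.11 p.416] -/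
theorem isSymmTr_dirInvY {w : S → ℝ} {P T : Module.End ℂ (S → Matrix (Fin N) (Fin N) ℂ)} (hP : IsSymmTr w P) (hT : IsSymmTr w T) :
    IsSymmTr w (dirInvY P T) :=
  isSymmTr_sandwich hP (isSymmTr_ringInverse w (isSymmTr_dirPadY hP hT))

end Generic

/-! ## §2 Symmetry of `G′_□(U)` with Dirichlet exterior -/

section Letters

open scoped Matrix.Norms.L2Operator

variable {d ℓ : ℕ} {hd : 1 ≤ d + 1} {hL : Odd (ℓ + 1) ∧ 1 < ℓ + 1} {b₀ b₁ : ℝ} {N : ℕ}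
variable (i : KIdx d ℓ hd hL b₀ b₁) (q : ↥(cubes (toKT i).D.toDomains)) {G : Subgroup (Matrix (Fin N) (Fin N) ℂ)ˣ}

/-- `Ω₀` (multiplication by the indicator of `S`) is symmetric for every weight. [cite: Balaban1985BackgroundPropagators, (3.24) p.394 («Ω₀ denotes a characteristic function»), bookkeeping] -/
theorem cubeProjY_isSymmTr (w : SiteY i → ℝ) (S : Finset (SiteY i)) : IsSymmTr w (cubeProjY (𝔸 := Matrix (Fin N) (Fin N) ℂ) i S) :=
  fun Φ Ψ => by rw [trIP_cubeProjY_left, ← trIP_cubeProjY_right]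

/-- the padded compression `Ω₀Δ′_{a,□}(U)Ω₀ + 1 − Ω₀` is symmetric when `Δ′_{a,□}(U)` is. [cite: Balaban1985BackgroundPropagators, (3.24) p.394, Thm 3.11 p.416] -/
theorem padDeltaCubeY_isSymmTr_of {w : SiteY i → ℝ} (par : SiteParY (Matrix (Fin N) (Fin N) ℂ) i) (S : Finset (SiteY i))
    {U : CfgY (Matrix (Fin N) (Fin N) ℂ) i} (hΔ : IsSymmTr w (deltaPrimeACubeY i q par U)) : IsSymmTr w (padDeltaCubeY i q par S U) :=
  isSymmTr_dirPadY (cubeProjY_isSymmTr i w S) hΔ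

/-- ★ **`G′_□(U)` (Dirichlet exterior `S`) IS SYMMETRIC WHEN `Δ′_{a,□}(U)` IS** — invertible or not, every weight. [cite: Balaban1985BackgroundPropagators, (3.25) p.394, Thm 3.11 p.416 («symmetric»), pp.408–409] -/
theorem GpDirY_isSymmTr_of {w : SiteY i → ℝ} (par : SiteParY (Matrix (Fin N) (Fin N) ℂ) i) (S : Finset (SiteY i))
    {U : CfgY (Matrix (Fin N) (Fin N) ℂ) i} (hΔ : IsSymmTr w (deltaPrimeACubeY i q par U)) : IsSymmTr w (GpDirY i q par S U) :=
  isSymmTr_dirInvY (cubeProjY_isSymmTr i w S) hΔ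

/-- on any inverse-symmetric `G`-valued transporter table (`G ≤ U(N)`) at a `G`-valued `U`, `G′_□(U)` is symmetric for the weight-one pairing.
[cite: Balaban1985BackgroundPropagators, (3.24)–(3.25) p.394, p.409, Thm 3.11 p.416] -/
theorem GpDirY_isSymmTr_of_inv_symm (hG : G ≤ B7Prop2Explicit.unitaryUnits (Matrix (Fin N) (Fin N) ℂ)) (par : SiteParY (Matrix (Fin N) (Fin N) ℂ) i)
    (S : Finset (SiteY i)) (U : CfgY (Matrix (Fin N) (Fin N) ℂ) i) (hinv : ∀ z z' : SiteY i, par U z z' = (par U z' z)⁻¹)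
    (hpar : ∀ z w : SiteY i, par U z w ∈ G) (hU : ∀ μ x, U μ x ∈ G) : IsSymmTr (fun _ => (1 : ℝ)) (GpDirY i q par S U) :=
  GpDirY_isSymmTr_of i q par S (deltaPrimeACubeY_isSymmTr_of_inv_symm i q hG par U hinv hpar hU)

/-- ★★ **THE CONSUMER's `hOsym` AT THE KNIT TABLE**: `G′_□(U; parKnitY)` with Dirichlet exterior `S` is symmetric whenever `U` and the knit legs are `G`-valued,
`G ≤ U(N)` (the `S = univ` face is ✓`GpCubeY_parKnitY_isSymmTr`; the legs' unitarity `hpar` is DISPLAYED — in the tree today inside the [B7] Prop-2 window only,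
✓`B9Eq3124HZKnitPairReg335Y.parKnitY_mem_unitary_of_reg335P`). [cite: Balaban1985BackgroundPropagators, (3.24)–(3.25) p.394, p.409, Thm 3.11 p.416] -/
theorem GpDirY_parKnitY_isSymmTr (hG : G ≤ B7Prop2Explicit.unitaryUnits (Matrix (Fin N) (Fin N) ℂ)) (S : Finset (SiteY i))
    {U : CfgY (Matrix (Fin N) (Fin N) ℂ) i} (hU : ∀ μ x, U μ x ∈ G) (hpar : ∀ z w : SiteY i, parKnitY i U z w ∈ G) :
    IsSymmTr (fun _ => (1 : ℝ)) (GpDirY i q (parKnitY i) S U) :=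
  GpDirY_isSymmTr_of_inv_symm i q hG (parKnitY i) S U (parKnitY_inv i U) hpar hU

/-- and at def-Y's symmetrised table `parSymY`, for every `G`-valued `U`. [cite: Balaban1985BackgroundPropagators, (3.24)–(3.25) p.394, p.409, Thm 3.11 p.416] -/
theorem GpDirY_parSymY_isSymmTr (hG : G ≤ B7Prop2Explicit.unitaryUnits (Matrix (Fin N) (Fin N) ℂ)) (S : Finset (SiteY i))
    {U : CfgY (Matrix (Fin N) (Fin N) ℂ) i} (hU : ∀ μ x, U μ x ∈ G) : IsSymmTr (fun _ => (1 : ℝ)) (GpDirY i q (parSymY i) S U) :=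
  GpDirY_isSymmTr_of i q (parSymY i) S (deltaPrimeACubeY_parSymY_isSymmTr i q hG hU)

/-! ## §3 The transposed local-inverse law `h G′_□ Δ′_a h = h²` -/

/-- pure algebra, against the cube-sequence operator: for a cut-off supported in `S`, `h G′_□(U) Δ′_{a,□}(U) h = h²` (from `G′_□ Ω₀ = G′_□`, `G′_□(Ω₀Δ′_{a,□}Ω₀) = Ω₀`).
[cite: Balaban1985BackgroundPropagators, (3.25) p.394, (3.87)–(3.88) p.409] -/
theorem cutMulY_GpDirY_deltaPrimeACubeY_cutMulY {𝔸 : Type} [NormedRing 𝔸] [NormedAlgebra ℂ 𝔸] [CompleteSpace 𝔸] (par : SiteParY 𝔸 i)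
    {S : Finset (SiteY i)} {U : CfgY 𝔸 i} (hU : IsUnit (padDeltaCubeY i q par S U)) (h : SiteY i → ℝ) (hS : ∀ z, h z ≠ 0 → z ∈ S) :
    cutMulY h * GpDirY i q par S U * deltaPrimeACubeY i q par U * cutMulY h = cutMulY h * cutMulY h :=
  calc cutMulY h * GpDirY i q par S U * deltaPrimeACubeY i q par U * cutMulY h
        = cutMulY h * (GpDirY i q par S U * cubeProjY i S) * deltaPrimeACubeY i q par U * (cubeProjY i S * cutMulY h) := by
          rw [GpDirY_mul_cubeProjY, cubeProjY_mul_cutMulY i h hS]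
    _ = cutMulY h * (GpDirY i q par S U * (cubeProjY i S * deltaPrimeACubeY i q par U * cubeProjY i S)) * cutMulY h := by
          simp only [mul_assoc]
    _ = cutMulY h * cubeProjY i S * cutMulY h := by rw [GpDirY_mul_compr_deltaPrimeACubeY i q par hU]
    _ = cutMulY h * cutMulY h := by rw [cutMulY_mul_cubeProjY i h hS]

/-- ★★ **THE CONSUMER's `hOlocT` — THE TRANSPOSED LOCAL-INVERSE LAW `h G′_□(U) Δ′_a(U) h = h²` FROM `IsUnit (𝟙_SΔ′_{a,□}(U)𝟙_S ⊕ 1)` ALONE**, for any site transporter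
and any cut-off `h` supported in `S` whose stencil-support lies near □ (COLUMN agreement `Δ′_a h = Δ′_{a,□} h`, ✓`OpsYLocalInverseSeq.deltaPrimeAY_mul_cutMulY_eq'`; at print's
`h_□` the stencil clause is ✓`OpsYLocalInverseSeq.nearH_of_mem_stencilY_hTY`).  The twin of FILE E's ROW law `cutMulY_deltaPrimeAY_GpDirY_cutMulY`.
[cite: Balaban1985BackgroundPropagators, (3.87)–(3.88), (3.90) p.409, p.408 l.35–p.409 l.5] -/
theorem cutMulY_GpDirY_deltaPrimeAY_cutMulY {𝔸 : Type} [NormedRing 𝔸] [NormedAlgebra ℂ 𝔸] [CompleteSpace 𝔸] (par : SiteParY 𝔸 i)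
    {S : Finset (SiteY i)} {U : CfgY 𝔸 i} (hU : IsUnit (padDeltaCubeY i q par S U)) (h : SiteY i → ℝ) (hS : ∀ z, h z ≠ 0 → z ∈ S)
    (hh : ∀ z w : SiteY i, w ∈ stencilY i z → h w ≠ 0 → NearH q z.1) :
    cutMulY h * GpDirY i q par S U * deltaPrimeAY i par U * cutMulY h = cutMulY h * cutMulY h := by
  rw [mul_assoc (cutMulY h * GpDirY i q par S U), deltaPrimeAY_mul_cutMulY_eq' i q par U h hh, ← mul_assoc]
  exact cutMulY_GpDirY_deltaPrimeACubeY_cutMulY i q par hU h hS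

end Letters

end

end Literature.MathematicalPhysics.QuantumFieldTheory.Balaban1983to89.Node00.OpsYCubeDirInverseSymm
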